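import Mathlib
import Literature.Computability.Complexity.SymPlus
import Literature.Computability.Complexity.BoolEncodings

/-!
# Separable rung of C⁺ (`LevelSetDiscrepancy chi₂`) — lead composition file, crux stmt-PneNP-0037, line Sketch

C⁺ restricted to SEPARABLE `SYM⁺` term systems (no AND-term touches both halves of the input) follows
from Heath-Brown's quadratic large sieve, bilinear form (Acta Arith. 72 (1995), Cor. 4), taken here as the
explicit hypothesis `hHB` (to be filed as a Literature named fact). Three registered rung stubs, all stated
WITHOUT the line's Defs vocabulary (`chi₂ n x` is written unfolded:
`jacobiSym ↑(bitsToNat ((List.ofFn x).take ((List.ofFn x).length / 2))) (2 * bitsToNat (…drop…) + 1)`):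

* `stub_coprimePairs_lower` — `#{x | χ₂ x ≠ 0} ≥ 2ⁿ / (4 n)` eventually (Chebyshev: many prime moduli);
* `stub_separable_split` — a separable level-set sum is an integer double sum
  `Σ_{u < 2^{n/2}} Σ_{w < 2^{n - n/2}} [R₁ u + R₂ w = v] (u | 2w+1)` with `R₁ ≤ size`;
* `stub_separable_bilinear_bound` — Heath-Brown Cor. 4 ⟹ that double sum times `(K+1)·4n` is `< 2ⁿ`
  eventually, uniformly in `R₁ ≤ K ≤ 2^{(log₂ n+2)^e}`, `R₂`, `v`;

and the composition `levelSet_separable_of_heathBrown`.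
-/

set_option linter.dupNamespace false -- `Summit.PneNP.PneNP.…`: summit = sub-problem (D-0017)

namespace Summit.PneNP.PneNP.Theorems.CircuitNpAcc0

open Finset Literature.Computability.Complexity

/-- RUNG STUB R-A (`stub_coprimePairs_lower`): eventually `2ⁿ ≤ 4 n · #{x : Fin n → Bool | χ₂ x ≠ 0}`
(pairs `(u, v)` with `2v+1` an odd prime `≤ 2^{⌈n/2⌉+1} − 1` not dividing `u` are `≥ 2^{⌊n/2⌋}/2 · (π(2^{⌈n/2⌉+1}) − 1)`;
Chebyshev's bound `Chebyshev.pi_ge`/`theta_ge` in Mathlib). -/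
theorem stub_coprimePairs_lower : ∃ n₀ : ℕ, ∀ n ≥ n₀,
    (2 : ℤ) ^ n ≤ 4 * (n : ℤ) * ((univ.filter fun x : Fin n → Bool =>
      jacobiSym (↑(bitsToNat ((List.ofFn x).take ((List.ofFn x).length / 2))))
        (2 * bitsToNat ((List.ofFn x).drop ((List.ofFn x).length / 2)) + 1) ≠ 0).card : ℤ) := by
  sorry

/-- RUNG STUB R-B (`stub_separable_split`): for a SEPARABLE term system (every AND-term lies inside the low
half `i < n/2` or inside the high half `n/2 ≤ i`), the count splits as `R₁(u) + R₂(w)` along the bijection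
`x ↦ (u, w) = (N(low half), N(high half))` of `Fin n → Bool` with `[0, 2^{n/2}) × [0, 2^{n-n/2})`, `R₁ ≤ size`,
so every level-set character sum is an integer double sum. -/
theorem stub_separable_split : ∀ {n : ℕ} (S : SymPlus n),
    (∀ t ∈ S.terms, (∀ i ∈ t, (i : ℕ) < n / 2) ∨ (∀ i ∈ t, n / 2 ≤ (i : ℕ))) →
    ∃ R₁ R₂ : ℕ → ℕ, (∀ u, R₁ u ≤ S.size) ∧ ∀ v : ℕ,
      ∑ x ∈ univ.filter (fun x : Fin n → Bool => S.count x = v),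
        jacobiSym (↑(bitsToNat ((List.ofFn x).take ((List.ofFn x).length / 2))))
          (2 * bitsToNat ((List.ofFn x).drop ((List.ofFn x).length / 2)) + 1) =
      ∑ u ∈ range (2 ^ (n / 2)), ∑ w ∈ range (2 ^ (n - n / 2)),
        if R₁ u + R₂ w = v then jacobiSym (u : ℤ) (2 * w + 1) else 0 := by
  sorry

/-- RUNG STUB R-C (`stub_separable_bilinear_bound`): Heath-Brown's bilinear quadratic large sieve
(Acta Arith. 72 (1995), Cor. 4, real-coefficient form — the hypothesis `hHB`) bounds the split double sum:
decompose over the `≤ K+1` values `a` of `R₁` into bilinear sums over `{R₁ = a} × {R₂ = v − a}`, each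
`≪_ε 2^{εn} 2^{3n/4+2}`; with `K ≤ 2^{(log₂ n+2)^e}` the total times `(K+1)·4n` is `< 2ⁿ` for large `n`. -/
theorem stub_separable_bilinear_bound :
    (∀ ε : ℝ, 0 < ε → ∃ C : ℝ, ∀ (M N : ℕ) (a b : ℕ → ℝ), (∀ m, |a m| ≤ 1) → (∀ k, |b k| ≤ 1) →
      |∑ m ∈ (range (M + 1)).filter (fun m => Odd m), ∑ k ∈ Icc 1 N, a m * b k * (jacobiSym (k : ℤ) m : ℝ)| ≤
        C * ((M : ℝ) * N) ^ ε * ((M : ℝ) * Real.sqrt N + Real.sqrt M * N)) →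
    ∀ e : ℕ, ∃ n₀ : ℕ, ∀ n ≥ n₀, ∀ K : ℕ, K ≤ 2 ^ (Nat.log 2 n + 2) ^ e → ∀ R₁ R₂ : ℕ → ℕ,
      (∀ u, R₁ u ≤ K) → ∀ v : ℕ,
      |∑ u ∈ range (2 ^ (n / 2)), ∑ w ∈ range (2 ^ (n - n / 2)),
          if R₁ u + R₂ w = v then jacobiSym (u : ℤ) (2 * w + 1) else 0| * (((K : ℤ) + 1) * (4 * n)) <
        (2 : ℤ) ^ n := by
  sorry

/-- **SEPARABLE RUNG OF C⁺** (lead composition, sorry-free modulo the three rung stubs): under Heath-Brown's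
bilinear bound, for every exponent `e` and all large `n`, every separable term system with at most
`2^{(log₂ n+2)^e}` terms (no fan-in hypothesis needed) satisfies the level-set discrepancy inequality of
`LevelSetDiscrepancy chi₂` (stated with `chi₂` unfolded). -/
theorem levelSet_separable_of_heathBrown
    (hHB : ∀ ε : ℝ, 0 < ε → ∃ C : ℝ, ∀ (M N : ℕ) (a b : ℕ → ℝ), (∀ m, |a m| ≤ 1) → (∀ k, |b k| ≤ 1) →
      |∑ m ∈ (range (M + 1)).filter (fun m => Odd m), ∑ k ∈ Icc 1 N, a m * b k * (jacobiSym (k : ℤ) m : ℝ)| ≤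
        C * ((M : ℝ) * N) ^ ε * ((M : ℝ) * Real.sqrt N + Real.sqrt M * N)) :
    ∀ e : ℕ, ∃ n₀ : ℕ, ∀ n ≥ n₀, ∀ S : SymPlus n, S.size ≤ 2 ^ (Nat.log 2 n + 2) ^ e →
      (∀ t ∈ S.terms, (∀ i ∈ t, (i : ℕ) < n / 2) ∨ (∀ i ∈ t, n / 2 ≤ (i : ℕ))) →
      ∀ v : ℕ, |∑ x ∈ univ.filter (fun x : Fin n → Bool => S.count x = v),
          jacobiSym (↑(bitsToNat ((List.ofFn x).take ((List.ofFn x).length / 2))))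
            (2 * bitsToNat ((List.ofFn x).drop ((List.ofFn x).length / 2)) + 1)| * ((S.size : ℤ) + 1) <
        ((univ.filter fun x : Fin n → Bool =>
          jacobiSym (↑(bitsToNat ((List.ofFn x).take ((List.ofFn x).length / 2))))
            (2 * bitsToNat ((List.ofFn x).drop ((List.ofFn x).length / 2)) + 1) ≠ 0).card : ℤ) := by
  intro e
  obtain ⟨n₁, hn₁⟩ := stub_coprimePairs_lower
  obtain ⟨n₂, hn₂⟩ := stub_separable_bilinear_bound hHB e
  refine ⟨max (max n₁ n₂) 1, fun n hn S hsize hsep v => ?_⟩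
  have hn1 : n₁ ≤ n := le_trans (le_trans (le_max_left _ _) (le_max_left _ _)) hn
  have hn2 : n₂ ≤ n := le_trans (le_trans (le_max_right _ _) (le_max_left _ _)) hn
  have hnpos : (0 : ℤ) < 4 * (n : ℤ) := by
    have : 1 ≤ n := le_trans (le_max_right _ _) hn
    positivity
  obtain ⟨R₁, R₂, hR₁, hsplit⟩ := stub_separable_split S hsep
  have hA := hn₁ n hn1
  have hB := hn₂ n hn2 S.size hsize R₁ R₂ hR₁ v
  rw [hsplit v]
  set T := |∑ u ∈ range (2 ^ (n / 2)), ∑ w ∈ range (2 ^ (n - n / 2)),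
      if R₁ u + R₂ w = v then jacobiSym (u : ℤ) (2 * w + 1) else 0| with hT
  set A := ((univ.filter fun x : Fin n → Bool =>
      jacobiSym (↑(bitsToNat ((List.ofFn x).take ((List.ofFn x).length / 2))))
        (2 * bitsToNat ((List.ofFn x).drop ((List.ofFn x).length / 2)) + 1) ≠ 0).card : ℤ) with hAdef
  have hT0 : 0 ≤ T := abs_nonneg _
  -- `T (size+1) · 4n < 2ⁿ ≤ 4n · A`, divide by `4n > 0`
  have h1 : T * ((S.size : ℤ) + 1) * (4 * n) < 4 * (n : ℤ) * A := by
    calc T * ((S.size : ℤ) + 1) * (4 * n) = T * (((S.size : ℤ) + 1) * (4 * n)) := by ring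
      _ < (2 : ℤ) ^ n := hB
      _ ≤ 4 * (n : ℤ) * A := hA
  by_contra hcon
  push Not at hcon
  have : 4 * (n : ℤ) * A ≤ T * ((S.size : ℤ) + 1) * (4 * n) := by
    calc 4 * (n : ℤ) * A ≤ 4 * (n : ℤ) * (T * ((S.size : ℤ) + 1)) :=
          mul_le_mul_of_nonneg_left hcon hnpos.le
      _ = T * ((S.size : ℤ) + 1) * (4 * n) := by ring
  exact absurd (lt_of_le_of_lt this h1) (lt_irrefl _)

end Summit.PneNP.PneNP.Theorems.CircuitNpAcc0
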